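import Summits.QuantumAdvantage.QuantumAdvantage.Theorems.CubicForrelationSignedExactSliceIsLiftDefs
import Literature.Computability.Complexity.CodeFPStringKit
import Literature.Computability.Complexity.SumcheckMAReferee

/-!
# Stub `stub_canonFP` of line `Sketch` (crux K2 `SignedExactSliceIsLift`, stmt-QuantumAdvantage-14830)

The FRONT END of the Möbius canonicaliser as typed polynomial-time plumbing (`CodeFP`) on EVERY string (source
code `strE = id`, so the conclusion `CodeFP strE instE canonMirror` reads `∃ f ∈ FP, ∀ x, f x = instE (canonMirror x)`):
GIVEN the two certificates of the neighbours — F₂ `(1ⁿ, c) ↦ cubicMonomials n (evalP c)` (Möbius coefficients of a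
circuit oracle) and F₁ `(1ⁿ, mons) ↦ anfPC n mons` (netlist emission), both with `n` in UNARY — the canonical mirror
instance of a string is computed on codes. Pieces: the TOTAL parser `parse` (field access `fstF`/`sndF`, the value
`strVal` of a numeral field, the total raw-list decoder `SumcheckMA.decNilC`, `map₀`; wires by the head bit
`HashBricks.headBitFn`, `List.tail` and `consBit`); the guard `guardOK` (`natEq` for `k = 2`, parity through `natMod`,
`natLeUn` against the unary length `strLength`); the unary budget `min n (L + 1)` (`unOfNatMin`), which EQUALS `n`
under the guard; `CodeFP.ite` between the guarded instance `(n, 2, [anfPC n (cubicMonomials n (evalP c₀)), …c₁…])`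
and the constant junk instance `(0, 2, [anfPC 0 [], anfPC 0 []])`; and the pointwise identification with
`canonMirror x = canonOf (parse x) |x|` (`min_eq_left` under the guard). No mathematics.
[cite: AroraBarak2009, §1.3 (closure of polynomial time under composition and bounded loops)]
-/

set_option linter.dupNamespace false -- D-0017: single-problem summit ⇒ `QuantumAdvantage.QuantumAdvantage` by design

noncomputable section

namespace Summit.QuantumAdvantage.QuantumAdvantage.Theorems.SignedExactSliceIsLift

open _root_.Computability Literature.Computability.Complexity Literature.Computability.Cryptography
  Literature.Computability.QuantumComplexity
open Literature.Computability.Complexity.CodeFP (strE unE natE bitE pairE rawE)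
open Summit.QuantumAdvantage.QuantumAdvantage.Theses.CubicForrelation (NearExactIsExact SignedExactSliceIsLift)

namespace StubCanonFP

open ForrCode Literature.Computability.Complexity.Brick Literature.Computability.Complexity.CodeFP

/-! ### The total parser on codes -/

/-- **The total wire parser on codes**: `v ↦ wireE (parseWire v) = v.headD false :: bin ⟦v.tail⟧` (head bit by
`HashBricks.headBitFn`, tail by `List.tail ∈ FP`, value by `strVal`, reassembled by `consBit`). -/
theorem parseWire_codeFP : CodeFP strE wireE parseWire :=
  have hhead : CodeFP strE bitE (fun v : List Bool => v.headD false) :=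
    of_fn HashBricks.headBitFn HashBricks.headBitFn_mem_FP fun v => HashBricks.headBitFn_apply v
  have htail : CodeFP strE strE List.tail := of_fn List.tail PRelSigma.tail_mem_FP fun _ => rfl
  (consBit.comp (hhead.pair (strOfNat.comp (strVal.comp htail)))).recodeOut fun _ => rfl

/-- **The total instance parser on codes** (a normaliser: `x ↦ instE (parse x)` on EVERY string): fields by
`fstF`/`sndF`, numerals by `strVal`, item lists by the total decoder `SumcheckMA.decNilC` and `map₀` (gates, then
circuits, then the instance). -/
theorem parse_codeFP : CodeFP strE instE parse := by
  have hf : CodeFP strE strE fstF := of_fn fstF fstF_mem_FP fun _ => rfl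
  have hs : CodeFP strE strE sndF := of_fn sndF sndF_mem_FP fun _ => rfl
  have hgate : CodeFP strE pgE parseGate :=
    (hf.pair ((map₀ parseWire_codeFP).comp (SumcheckMA.decNilC.comp hs))).congr fun _ => rfl
  have hpc : CodeFP strE pcE parsePC :=
    (((map₀ hgate).comp (SumcheckMA.decNilC.comp hf)).pair (parseWire_codeFP.comp hs)).congr fun _ => rfl
  exact ((strVal.comp hf).pair ((strVal.comp (hf.comp hs)).pair
    ((map₀ hpc).comp (SumcheckMA.decNilC.comp (hs.comp hs))))).congr fun _ => rfl

/-! ### The guard and the unary budget -/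

/-- **The guard on codes**: `x ↦ guardOK (parse x) |x|` (`k = 2` by `natEq`; parity of the binary `n` through
`natMod`; `n ≤ |x| + 1` by `natLeUn` against the unary successor of `strLength`). -/
theorem guard_codeFP : CodeFP strE bitE (fun x => guardOK (parse x) x.length) := by
  have ht := parse_codeFP
  have hk : CodeFP strE bitE (fun x => decide ((parse x).2.1 = 2)) :=
    natEq.comp ((instK_codeFP.comp ht).pair (const strE (eβ := natE) (2 : ℕ)))
  have heven : CodeFP natE bitE (fun n => decide (Even n)) :=
    (natEq.comp ((natMod.comp ((CodeFP.id natE).pair (const natE (eβ := natE) (2 : ℕ)))).pair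
      (const natE (eβ := natE) (0 : ℕ)))).congr fun _ => decide_eq_decide.2 Nat.even_iff.symm
  have he : CodeFP strE bitE (fun x => decide (Even (parse x).1)) := heven.comp (instN_codeFP.comp ht)
  have hl : CodeFP strE bitE (fun x => decide ((parse x).1 ≤ x.length + 1)) :=
    natLeUn.comp ((instN_codeFP.comp ht).pair (unSucc.comp strLength))
  exact (hk.and (he.and hl)).congr fun _ => rfl

/-- **The unary budget** `x ↦ 1^{min n (|x| + 1)}` (`n = (parse x).1` is binary; the capped conversion
`unOfNatMin` — equal to `n` under the guard). -/
theorem nEff_codeFP : CodeFP strE unE (fun x => min (parse x).1 (x.length + 1)) :=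
  (unOfNatMin.comp ((unSucc.comp strLength).pair (instN_codeFP.comp parse_codeFP))).congr fun _ => rfl

/-! ### The composition -/

/-- **The canonical mirror instance on codes**, from the two stage certificates F₂ (coefficients) and F₁
(emission). -/
theorem canonMirror_codeFP
    (hF₂ : CodeFP (pairE unE pcE) (rawE (rawE natE)) (fun p => cubicMonomials p.1 (evalP p.2)))
    (hF₁ : CodeFP (pairE unE (rawE (rawE natE))) pcE (fun p => anfPC p.1 p.2)) :
    CodeFP strE instE canonMirror := by
  have ht := parse_codeFP
  have hn : CodeFP strE natE (fun x => (parse x).1) := instN_codeFP.comp ht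
  have hne := nEff_codeFP
  -- expected types only through `.congr` (unifying `(?g a).1 =?= parse a` unfolds `parse`: slow whnf)
  have hc : ∀ i : ℕ, CodeFP strE pcE (fun x => circAt (parse x) i) := fun i =>
    (circAt_codeFP.comp (ht.pair (const strE (eβ := natE) i))).congr fun _ => rfl
  -- no expected types from here on; `dsimp` at the end
  have hanf := fun i : ℕ => hF₁.comp (hne.pair (hF₂.comp (hne.pair (hc i))))
  have hG := hn.pair ((const strE (eβ := natE) (2 : ℕ)).pair ((rawCons pcE).comp ((hanf 0).pair
    ((rawSingleton pcE).comp (hanf 1)))))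
  have hZ : CodeFP strE instE (fun _ => ((0, 2, [anfPC 0 [], anfPC 0 []]) : Inst)) :=
    const strE ((0, 2, [anfPC 0 [], anfPC 0 []]) : Inst)
  refine (guard_codeFP.ite hG hZ).congr fun x => ?_
  dsimp only
  unfold canonMirror canonOf
  by_cases hg : guardOK (parse x) x.length = true
  · have hle : (parse x).1 ≤ x.length + 1 := by
      simp only [guardOK, Bool.and_eq_true, decide_eq_true_eq] at hg
      exact hg.2.2
    rw [if_pos hg, if_pos hg, min_eq_left hle]
  · rw [if_neg hg, if_neg hg]

end StubCanonFP

/-- **STUB F₃ (front end)**: total parsing + guard + unary budget + the two stages F₂ (Möbius coefficients of a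
circuit oracle) and F₁ (netlist emission) give the canonicaliser `x ↦ instE (canonMirror x)` on EVERY string. -/
theorem stub_canonFP :
    CodeFP (pairE unE ForrCode.pcE) (rawE (rawE natE)) (fun p => cubicMonomials p.1 (ForrCode.evalP p.2)) →
    CodeFP (pairE unE (rawE (rawE natE))) ForrCode.pcE (fun p => anfPC p.1 p.2) →
    CodeFP strE ForrCode.instE canonMirror :=
  fun hF₂ hF₁ => StubCanonFP.canonMirror_codeFP hF₂ hF₁

end Summit.QuantumAdvantage.QuantumAdvantage.Theorems.SignedExactSliceIsLift

end
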